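import Mathlib
import Literature.Analysis.FluidPDE.TaoClassGlue
import Literature.Analysis.FluidPDE.CheskidovShvydkoyRegularProofs
import Literature.Analysis.FluidPDE.TaoLocalisation
import Literature.Analysis.FluidPDE.AxisymmetricNoSwirlGlobal
import Literature.Analysis.FluidPDE.RapidDecayLemmas
import Literature.Analysis.FluidPDE.ForcedFourierForceData
import Summits.NavierStokesRegularity.NavierStokesRegularity.Theses.QuasipotentialCoercivity
import HarnessLib

/-!
# `QuasipotentialCoercivity.ActionCoercivityEnstrophyOfTypeSplit` — the Type-I / Type-II split glue
  (item stmt-NavierStokesRegularity-17735)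

**Statement.** `ScaledEnergyActionBound → TypeIActionCoercivity → ActionCoercivityEnstrophy` (the three
route statements inlined verbatim in the item: child II = stmt-17724, child I = stmt-17720, parent =
stmt-1443).

PROOF — adapted from the planner's sorry-free composition in the registered skeleton
`Cruxes/ActionCoercivityEnstrophy/Lines/type_split.lean` (`actionCoercivityEnstrophy_of_subs`; the
planner cannot write `Theorems/`, the item note asks a prover to land it). Given `(ν, τ, a)`, child II
gives `M` with Type-I control `∫_{B(y,r)}|x|² ≤ M r` of every reachable STATE; the reachable set is
CLOSED UNDER TRUNCATION, so every SLICE of an admissible path is Type-I controlled with that `M`,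
and child I applies with `C = C(ν, τ, a, M)`: tail slices `v s` are terminal states of the same
path with a shorter tail; slices `w s`, `0 < s`, of the forced piece are terminal states of the
restricted forced piece `w|[0,s]` (classical solutions and UNIFORM Schwartz decay restrict to
sub-slabs, `iteratedFDerivWithin_subset`) followed by a zero-length free tail inside the local
classical Leray–Hopf solution from the Schwartz divergence-free slice `w s` (Tao 2013 Thm. 5.4,
PROVED in the tree: `tao2011_smooth_local_existence_holds`, `IsTaoSolutionOn.of_tao`,
`.isLerayHopfOn`); the slice `w 0 = 0` is trivial.

HONEST FRAMING: the seam of a split whose two children are open-problem-grade; nothing here bears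
on either child or on regularity.
-/

noncomputable section

set_option linter.dupNamespace false

namespace Summit.NavierStokesRegularity.NavierStokesRegularity.Theorems.ActionCoercivityEnstrophySplit

open Literature.Analysis.FluidPDE MeasureTheory Set Function Filter Topology Metric
open scoped ENNReal NNReal Pointwise ContDiff

section Slice

variable {X : Type*} [NormedAddCommGroup X] [NormedSpace ℝ X]
variable {F : Type*} [NormedAddCommGroup F] [NormedSpace ℝ F]

/-- **Uniform Schwartz decay restricts to sub-slabs**: on `[0, s] ⊆ [0, T₀]`, `0 < s`, the joint
derivatives within the smaller slab agree with those within the larger one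
(Mathlib `iteratedFDerivWithin_subset`), so the uniform decay constants are inherited. [folklore] -/
-- adapted from Cruxes/ActionCoercivityEnstrophy/Lines/type_split.lean (planner skeleton, sorry-free part)
theorem hasUniformRapidDecayOn_mono_Icc {T₀ s : ℝ} {w : ℝ → X → F}
    (h : IsSmoothSpaceTimeOn (Icc 0 T₀) w) (hd : HasUniformRapidDecayOn (Icc 0 T₀) w)
    (hs0 : 0 < s) (hsT : s ≤ T₀) : HasUniformRapidDecayOn (Icc 0 s) w := by
  intro n K
  obtain ⟨C, hC⟩ := hd n K
  refine ⟨C, fun t ht x => ?_⟩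
  have hsub : Icc (0 : ℝ) s ×ˢ (univ : Set X) ⊆ Icc 0 T₀ ×ˢ univ :=
    prod_mono (Icc_subset_Icc_right hsT) Subset.rfl
  rw [iteratedFDerivWithin_subset hsub ((uniqueDiffOn_Icc hs0).prod uniqueDiffOn_univ)
    ((uniqueDiffOn_Icc (hs0.trans_le hsT)).prod uniqueDiffOn_univ)
    (h.of_le (by exact_mod_cast le_top)) (mk_mem_prod ht (mem_univ x))]
  exact hC t (Icc_subset_Icc_right hsT ht) x

end Slice

/-! ### Local well-posedness from a forced slice (Tao 2013, Thm. 5.4, proved in tree) -/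

/-- **A zero-length free tail exists from every slice of an admissible forced piece.** If
`(w, q, g)` is a classical forced solution on `[0, T₀] × (EuclideanSpace ℝ (Fin 3))`, uniformly Schwartz, then from every
slice `w s`, `s ∈ [0, T₀]` — which is smooth, divergence free and Schwartz, hence `H^∞` — there is
a classical UNFORCED solution `(v, pv)` on some `[0, T₂)`, `T₂ > 0`, Leray–Hopf on `[0, T₂]` from
`w s`, with `v 0 = w s` (Tao 2013, Thm. 5.4 (ii)+(iv): `tao2011_smooth_local_existence_holds`,
lifespan `c ν³ / (‖w s‖⁴_{H¹} + 1)`). [cite: Tao2011, Thm. 5.4 (ii)+(iv)] -/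
theorem exists_free_tail_of_forced_slice {ν T₀ : ℝ} (hν : 0 < ν) (hT₀ : 0 < T₀)
    {w g : ℝ → (EuclideanSpace ℝ (Fin 3)) → (EuclideanSpace ℝ (Fin 3))} {q : ℝ → (EuclideanSpace ℝ (Fin 3)) → ℝ}
    (hsol : IsClassicalNSSolutionOn (Icc 0 T₀) ν g w q) (hd : HasUniformRapidDecayOn (Icc 0 T₀) w)
    {s : ℝ} (hs : s ∈ Icc 0 T₀) :
    ∃ T₂ : ℝ, 0 < T₂ ∧ ∃ (v : ℝ → (EuclideanSpace ℝ (Fin 3)) → (EuclideanSpace ℝ (Fin 3))) (pv : ℝ → (EuclideanSpace ℝ (Fin 3)) → ℝ),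
      IsClassicalNSSolutionOn (Ico 0 T₂) ν 0 v pv ∧ IsLerayHopfOn T₂ ν 0 (w s) v ∧ v 0 = w s := by
  have hsm : ContDiff ℝ ∞ (w s) := hsol.contDiff_velocity hs
  have hdiv : VectorCalculus.IsDivFree (w s) := hsol.divFree s hs
  have hdec : HasRapidSpatialDecay (w s) :=
    hd.hasRapidSpatialDecay_slice hsol.smooth_velocity hT₀ hs
  have hH : ∀ n : ℕ, ∫⁻ x, ‖iteratedFDeriv ℝ n (w s) x‖ₑ ^ 2 < ⊤ := fun n =>
    hdec.lintegral_enorm_iteratedFDeriv_sq_lt_top n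
  set A₀ : ℝ≥0∞ := (∫⁻ x, ‖w s x‖ₑ ^ 2) +
    ∫⁻ x, ENNReal.ofReal (frobeniusNormSq (fderiv ℝ (w s) x)) with hA₀
  have hA₀top : A₀ < ⊤ := by
    refine ENNReal.add_lt_top.2 ⟨?_, ?_⟩
    · rw [lintegral_enorm_sq_eq_lintegral_iteratedFDeriv_zero]
      exact hH 0
    · exact (lintegral_frobeniusNormSq_le_three_mul _).trans_lt
        (ENNReal.mul_lt_top (by simp) (hH 1))
  set A : ℝ := A₀.toReal with hA
  have hA0 : 0 ≤ A := ENNReal.toReal_nonneg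
  have hAle : A₀ ≤ ENNReal.ofReal A := (ENNReal.ofReal_toReal hA₀top.ne).ge
  obtain ⟨c, hc, hE⟩ := IsTaoSolutionOn.of_tao tao2011_smooth_local_existence_holds
  set T : ℝ := c * ν ^ 3 / (A ^ 2 + 1) with hTdef
  have hT : 0 < T := by positivity
  have hAT : A ^ 2 * T ≤ c * ν ^ 3 := by
    rw [hTdef, mul_div_assoc', div_le_iff₀ (by positivity)]
    nlinarith [sq_nonneg A, mul_pos hc (pow_pos hν 3)]
  obtain ⟨u, p, hu⟩ := hE hν hT hsm hdiv hH hA0 hAle hAT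
  exact ⟨T, hT, u, p, hu.classical.mono Ico_subset_Icc_self (uniqueDiffOn_Ico 0 T),
    hu.isLerayHopfOn hT, hu.initial⟩

/-! ### Truncation closure of the reachable set -/

/-- **Forced slices are reachable.** Every slice `w s`, `0 < s ≤ T₀`, of the forced piece of an
admissible path (`T₀ ≤ τ`) is the terminal state of an admissible path with the same `(ν, τ, a)`:
forced piece `w|[0, s]` (action only decreases), free tail of length `0` inside the local classical
solution from `w s` (`exists_free_tail_of_forced_slice`). [folklore] -/
theorem reach_forced_slice {ν τ T₀ : ℝ} {a : ℝ≥0} (hν : 0 < ν) (hT₀ : 0 < T₀) (hT₀τ : T₀ ≤ τ)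
    {w g : ℝ → (EuclideanSpace ℝ (Fin 3)) → (EuclideanSpace ℝ (Fin 3))} {q : ℝ → (EuclideanSpace ℝ (Fin 3)) → ℝ}
    (hsol : IsClassicalNSSolutionOn (Icc 0 T₀) ν g w q) (hd : HasUniformRapidDecayOn (Icc 0 T₀) w)
    (hw0 : w 0 = 0) (hact : (∫⁻ r in Icc 0 T₀, eEnergy (g r)) ≤ (a : ℝ≥0∞))
    {s : ℝ} (hs0 : 0 < s) (hsT : s ≤ T₀) :
    ∃ (T₀' T₁ : ℝ) (w' : ℝ → (EuclideanSpace ℝ (Fin 3)) → (EuclideanSpace ℝ (Fin 3))) (q' : ℝ → (EuclideanSpace ℝ (Fin 3)) → ℝ) (g' : ℝ → (EuclideanSpace ℝ (Fin 3)) → (EuclideanSpace ℝ (Fin 3))),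
      (0 < T₀' ∧ IsClassicalNSSolutionOn (Icc 0 T₀') ν g' w' q' ∧
        HasUniformRapidDecayOn (Icc 0 T₀') w' ∧ w' 0 = 0 ∧
        (∫⁻ r in Icc 0 T₀', eEnergy (g' r)) ≤ (a : ℝ≥0∞)) ∧
      (0 ≤ T₁ ∧ T₀' + T₁ ≤ τ ∧ ∃ (T₂ : ℝ) (v : ℝ → (EuclideanSpace ℝ (Fin 3)) → (EuclideanSpace ℝ (Fin 3))) (pv : ℝ → (EuclideanSpace ℝ (Fin 3)) → ℝ),
        T₁ < T₂ ∧ IsClassicalNSSolutionOn (Ico 0 T₂) ν 0 v pv ∧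
        IsLerayHopfOn T₂ ν 0 (w' T₀') v ∧ v 0 = w' T₀' ∧ v T₁ = w s) := by
  obtain ⟨T₂, hT₂, v, pv, hv, hLH, hv0⟩ :=
    exists_free_tail_of_forced_slice hν hT₀ hsol hd ⟨hs0.le, hsT⟩
  refine ⟨s, 0, w, q, g, ⟨hs0, hsol.mono (Icc_subset_Icc_right hsT) (uniqueDiffOn_Icc hs0),
    hasUniformRapidDecayOn_mono_Icc hsol.smooth_velocity hd hs0 hsT, hw0,
    (lintegral_mono_set (Icc_subset_Icc_right hsT)).trans hact⟩,
    ⟨le_rfl, by linarith, T₂, v, pv, hT₂, hv, hLH, hv0, hv0⟩⟩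

/-! ### The assembly -/

/-- **Typed split of the deciding crux (BC2 redirect):**
`ScaledEnergyActionBound → TypeIActionCoercivity → ActionCoercivityEnstrophy`.
Given `(ν, τ, a)`, child II gives `M` with Type-I control of every reachable STATE; by truncation
closure (`reach_forced_slice` for the forced piece — local well-posedness from Schwartz slices,
Tao 2013 Thm. 5.4 — and re-reading a shorter tail for the free piece, the slice `w 0 = 0` being
trivial) every SLICE of an admissible path is Type-I controlled with that `M`, so child I applies
with `C = C(ν, τ, a, M)`. [folklore] -/
theorem actionCoercivityEnstrophy_of_subs :
    (∀ ν : ℝ, 0 < ν → ∀ τ : ℝ, 0 < τ → ∀ a : NNReal, ∃ M : NNReal, ∀ x : EuclideanSpace ℝ (Fin 3) → EuclideanSpace ℝ (Fin 3), (∃ (T₀ T₁ : ℝ) (w : ℝ → EuclideanSpace ℝ (Fin 3) → EuclideanSpace ℝ (Fin 3)) (q : ℝ → EuclideanSpace ℝ (Fin 3) → ℝ) (g : ℝ → EuclideanSpace ℝ (Fin 3) → EuclideanSpace ℝ (Fin 3)), (0 < T₀ ∧ Literature.Analysis.FluidPDE.IsClassicalNSSolutionOn (Set.Icc 0 T₀)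 ν g w q ∧ Literature.Analysis.FluidPDE.HasUniformRapidDecayOn (Set.Icc 0 T₀) w ∧ w 0 = 0 ∧ (∫⁻ s in Set.Icc 0 T₀, Literature.Analysis.FluidPDE.eEnergy (g s)) ≤ (a : ENNReal)) ∧ (0 ≤ T₁ ∧ T₀ + T₁ ≤ τ ∧ ∃ (T₂ : ℝ) (v : ℝ → EuclideanSpace ℝ (Fin 3) → EuclideanSpace ℝ (Fin 3)) (pv : ℝ → EuclideanSpace ℝ (Fin 3) → ℝ), T₁ < T₂ ∧ Literature.Analysis.FluidPDE.IsClassicalNSSolutionOn (Set.Ico 0 T₂) ν 0 v pv ∧ Literature.Analysis.FluidPDE.IsLerayHopfOn T₂ ν 0 (w T₀) v ∧ v 0 = w T₀ ∧ v T₁ = x)) → ∀ (y : EuclideanSpace ℝ (Fin 3)) (r : ℝ), 0 < r → (∫⁻ z in Metric.ball y r, ‖x z‖ₑ ^ 2) ≤ (M : ENNReal) * ENNReal.ofReal r) →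
    (∀ ν : ℝ, 0 < ν → ∀ τ : ℝ, 0 < τ → ∀ a : NNReal, ∀ M : NNReal, ∃ C : NNReal, ∀ x : EuclideanSpace ℝ (Fin 3) → EuclideanSpace ℝ (Fin 3), (∃ (T₀ T₁ : ℝ) (w : ℝ → EuclideanSpace ℝ (Fin 3) → EuclideanSpace ℝ (Fin 3)) (q : ℝ → EuclideanSpace ℝ (Fin 3) → ℝ) (g : ℝ → EuclideanSpace ℝ (Fin 3) → EuclideanSpace ℝ (Fin 3)), (0 < T₀ ∧ Literature.Analysis.FluidPDE.IsClassicalNSSolutionOn (Set.Icc 0 T₀) ν g w q ∧ Literature.Analysis.FluidPDE.HasUniformRapidDecayOn (Set.Icc 0 T₀) w ∧ w 0 = 0 ∧ (∫⁻ s in Set.Icc 0 T₀, Literature.Analysis.FluidPDE.eEnergy (g s)) ≤ (a : ENNReal) ∧ (∀ s ∈ Set.Icc 0 T₀, ∀ (y : EuclideanSpace ℝ (Fin 3)) (r : ℝ), 0 < r → (∫⁻ z in Metric.ball y r, ‖w s z‖ₑ ^ 2) ≤ (M : ENNReal) * ENNReal.ofReal r)) ∧ (0 ≤ T₁ ∧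 T₀ + T₁ ≤ τ ∧ ∃ (T₂ : ℝ) (v : ℝ → EuclideanSpace ℝ (Fin 3) → EuclideanSpace ℝ (Fin 3)) (pv : ℝ → EuclideanSpace ℝ (Fin 3) → ℝ), T₁ < T₂ ∧ Literature.Analysis.FluidPDE.IsClassicalNSSolutionOn (Set.Ico 0 T₂) ν 0 v pv ∧ Literature.Analysis.FluidPDE.IsLerayHopfOn T₂ ν 0 (w T₀) v ∧ v 0 = w T₀ ∧ v T₁ = x ∧ (∀ s ∈ Set.Icc 0 T₁, ∀ (y : EuclideanSpace ℝ (Fin 3)) (r : ℝ), 0 < r → (∫⁻ z in Metric.ball y r, ‖v s z‖ₑ ^ 2) ≤ (M : ENNReal) * ENNReal.ofReal r))) → (∫⁻ y, ENNReal.ofReal (Literature.Analysis.FluidPDE.frobeniusNormSq (fderiv ℝ x y))) ≤ (C : ENNReal)) →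
    (∀ ν : ℝ, 0 < ν → ∀ τ : ℝ, 0 < τ → ∀ a : NNReal, ∃ C : NNReal, ∀ x : EuclideanSpace ℝ (Fin 3) → EuclideanSpace ℝ (Fin 3), (∃ (T₀ T₁ : ℝ) (w : ℝ → EuclideanSpace ℝ (Fin 3) → EuclideanSpace ℝ (Fin 3)) (q : ℝ → EuclideanSpace ℝ (Fin 3) → ℝ) (g : ℝ → EuclideanSpace ℝ (Fin 3) → EuclideanSpace ℝ (Fin 3)), (0 < T₀ ∧ Literature.Analysis.FluidPDE.IsClassicalNSSolutionOn (Set.Icc 0 T₀) ν g w q ∧ Literature.Analysis.FluidPDE.HasUniformRapidDecayOn (Set.Icc 0 T₀) w ∧ w 0 = 0 ∧ (∫⁻ s in Set.Icc 0 T₀, Literature.Analysis.FluidPDE.eEnergy (g s)) ≤ (a : ENNReal)) ∧ (0 ≤ T₁ ∧ T₀ + T₁ ≤ τ ∧ ∃ (T₂ : ℝ) (v : ℝ → EuclideanSpace ℝ (Fin 3) → EuclideanSpace ℝ (Fin 3)) (pv : ℝ → EuclideanSpace ℝ (Fin 3) → ℝ), T₁ < T₂ ∧ Literature.Analysis.FluidPDE.IsClassicalNSSolutionOn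 (Set.Ico 0 T₂) ν 0 v pv ∧ Literature.Analysis.FluidPDE.IsLerayHopfOn T₂ ν 0 (w T₀) v ∧ v 0 = w T₀ ∧ v T₁ = x)) → (∫⁻ y, ENNReal.ofReal (Literature.Analysis.FluidPDE.frobeniusNormSq (fderiv ℝ x y))) ≤ (C : ENNReal)) := by
  intro hII hI ν hν τ hτ a
  obtain ⟨M, hM⟩ := hII ν hν τ hτ a
  obtain ⟨C, hC⟩ := hI ν hν τ hτ a M
  refine ⟨C, ?_⟩
  rintro x ⟨T₀, T₁, w, q, g, ⟨hT₀, hsol, hdec, hw0, hact⟩, hT₁, hsum, T₂, v, pv, hT₁₂, hv, hLH, hv0, hvx⟩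
  have hT₀τ : T₀ ≤ τ := by linarith
  refine hC x ⟨T₀, T₁, w, q, g, ⟨hT₀, hsol, hdec, hw0, hact, ?_⟩, hT₁, hsum, T₂, v, pv, hT₁₂, hv,
    hLH, hv0, hvx, ?_⟩
  · -- slices of the forced piece: `w 0 = 0` is trivial, `w s` for `0 < s` is reachable
    intro s hs y r hr
    rcases hs.1.eq_or_lt with h0 | hs0
    · subst h0
      rw [hw0]
      simp
    · exact hM (w s) (reach_forced_slice hν hT₀ hT₀τ hsol hdec hw0 hact hs0 hs.2) y r hr
  · -- slices of the free tail: same forced piece, shorter tail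
    intro s hs y r hr
    exact hM (v s) ⟨T₀, s, w, q, g, ⟨hT₀, hsol, hdec, hw0, hact⟩, hs.1, by linarith [hs.2], T₂, v, pv,
      lt_of_le_of_lt hs.2 hT₁₂, hv, hLH, hv0, rfl⟩ y r hr



/-- **Item stmt-NavierStokesRegularity-17735** (`QuasipotentialCoercivity.ActionCoercivityEnstrophyOfTypeSplit`):
the Type-I/Type-II split glue `ScaledEnergyActionBound → TypeIActionCoercivity →
ActionCoercivityEnstrophy`, by truncation closure of the reachable set
(`actionCoercivityEnstrophy_of_subs`). [this file] -/
theorem quasipotentialCoercivity_actionCoercivityEnstrophyOfTypeSplit_proof :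
    Summit.NavierStokesRegularity.NavierStokesRegularity.Theses.QuasipotentialCoercivity.ActionCoercivityEnstrophyOfTypeSplit := by
  unfold Summit.NavierStokesRegularity.NavierStokesRegularity.Theses.QuasipotentialCoercivity.ActionCoercivityEnstrophyOfTypeSplit
  exact actionCoercivityEnstrophy_of_subs

end Summit.NavierStokesRegularity.NavierStokesRegularity.Theorems.ActionCoercivityEnstrophySplit

end
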